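import Summits.QuantumFields.YangMills.Theorems.UnitScaleTiltProp7TransplantGen1Engines
import Summits.QuantumFields.YangMills.Theorems.UnitScaleTiltProp7CovKernelTransplantAssembly
import HarnessLib

/-!
# Route `UnitScaleTilt`, crux K1 «MinimiserStabilityRegPr» (stmt-QuantumFields-19200), route-R E′ path (α′), (E1-b) at the CURVED background, (A-cov) gen-1, FILE C «GEN-1 NUMBERS»:
# THE THREE NON-TRIVIAL gen-1 NUMBERS `N2₁ H₁ S₁` OF ✓ `htr_body_of_rows'''` FOR GENERIC gen-1 FIELDS `F F′ c₁′ c₂′` WITH DISPLAYED ROWS — `F` (uniform size∕step rows `Φ₀ Φ₁`), `F′` (POINTWISE profiles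
# `p₀ p₁`), `c₁′` (profile `γ`), `c₂′` (profile `p₂`), supported in finsets on which the cone rows `0 ≤ t₁ ≤ T₁`, `0 ≤ t₂ ≤ T₂` and the weight `0 ≤ ω ≤ Ω` hold:
# (N2₁) `Σ_z √hs(Δ_U(R(Fr)F)) ≤ √N·(Σ_S p₀ + Σ_S γ) + √N·#S·d·((2T₂ + 4T₁²)Φ₀ + 4T₁Φ₁)`, (H₁) `√Σω²hs(K₁ + R(Fr)c₁′) ≤ Ω√N·√#S·d((2T₂ + 4T₁²)Φ₀ + 4T₁Φ₁) + Ω√Σ_S(√N·γ)²`,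
# (S₁) `√Σω²hs(K₂ − R(Fr)c₂′) ≤ Ω√N·(√Σ_S (d((2T₂ + 4T₁²)p₀ + 4T₁p₁))² + √Σ_S p₂²)` — the profile (not sup) forms px11 g4's (D2)(D3)(R-b)(R-c) located as necessary; (N3₁)(N4₁) `= 0` for `u₁ := 0`;
# then ALL FOUR IN CLOSED FORM under px22's cone letters and the radial profile shapes `Γ₁ + γ₁∕(1∨r)`, `a₀√(R₀∕(1∨r))`, `a₁∕(1∨r) + a₁′√(R₀∕(1∨r))`, `a₃ + a₂∕(1∨r) + a₄√(R₄∕(1∨r))`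

Cell `ym3-torus`, extra width seat `ym-routeR-w6` (gen 7); LOCATE-GEN1 §3∕§4 (19200 evidence #41), split of record ★routeR-w3 g6 00:31:08Z (A = px11 ✓p682215 engines, B∕C = routeR-w6, F2 = px11, `'''`∕member = px22).
GENERIC on purpose: px11 g4's F2 «CUTOFF + FIELD ROWS» supplies `F F′ c₁′ c₂′` with exactly these row shapes from FILE B ✓∕⧗ `…TransplantGen1F0Rows`; the 40-line glue instantiates.  THEOREMS ONLY (0 `def`, 0 `sorry`);
`--supports stmt-QuantumFields-19200`, count-neutral.  YM₃ on T³ is a ladder rung (R3), not the Clay problem; nothing here claims a stub, the crux, d = 4 or the mass gap.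

WHAT IS PROVED (ns `…Theorems.Prop7TransplantGen1Numbers`; torus `Site P i`, bi-contractive `U Fr`, `hs X = Σ‖X j k‖²`, flat Laplacian in the `Σ_μ((F z − F(T_μz)) + (F z − F(T_μ⁻¹z)))` letters of ✓p678447∕`'''`).
* §1 letters: `frameJunk_pointwise_le` (the pointwise cone profile under `0 ≤ t₁ ≤ T₁`, `0 ≤ t₂ ≤ T₂` and row functions), `sum_le_sqrt_card_mul_sqrt_sum_sq` (Cauchy–Schwarz `Σ_S q ≤ √#S·√Σ_S q²`).
* §2 ★★ `gen1_N2_le` (N2₁), ★★ `gen1_H1_le` (H₁), ★★★ `gen1_S1_le` (S₁), `gen1_N3_N4_zero` (N3₁ = N4₁ = 0 at `u₁ := 0`) — generic finset `S`, generic row functions∕profiles.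
* §3 `sum_sq_add_three_le`, ★★★ `gen1_numbers_closed` — the four conjuncts in CLOSED FORM under px22's cone letters `t₁ = A₁(r+1)`, `t₂ = A₀ + A₂(r+2)` on `S ⊆ S′` (radii `R ≤ R′`) and px11's
  (R-a)(R-b)(R-c) profile shapes `Γ₁ + γ₁∕(1∨r)`, `a₀√(R₀∕(1∨r))`, `a₁∕(1∨r) + a₁′√(R₀∕(1∨r))`, `a₃ + a₂∕(1∨r) + a₄√(R₄∕(1∨r))` (✓p682215 `sum_sq_sqrt_div_max_le`∕`sum_sq_div_max_le`, ✓`sum_inv_max_le`).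
HONEST SCOPE.  Counting over ✓p677027 (ℓ¹ engine, pointwise `t`), ✓p682215 (weighted profile engines), ✓p680867 §1 (weighted Minkowski); the closed radial forms and the member plug are the glue file.

References: T. Bałaban, CMP 99 (1985) 389–434 [Balaban1985BackgroundPropagators] ((3.8) p.392, (3.35) p.396); CMP 96 (1984) 223–250 [Balaban1984PropagatorsII] ((1.9) p.226);
CMP 99 (1985) 75–102 [Balaban1985RegularSpaces] ((1.36) p.82).
-/

set_option autoImplicit false

noncomputable section

open scoped BigOperators Matrix.Norms.L2Operator Matrix
open Finset

namespace Summit.QuantumFields.YangMills.Theorems.Prop7TransplantGen1Numbers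

open Literature.MathematicalPhysics.QuantumFieldTheory.Balaban1983to89
open B9Eq39Adjoint (R R_def covD covDstar divB)
open B9TorusCalculus (torusT torusT_apply torusT_symm_apply)
open Prop7TransplantNorms (hs_R_le covLaplace_eq_zero_of_vanish)
open Prop7TransplantNormsField (sum_sqrt_hs_covLaplace_framed_le)
open Prop7HSOpNormSeam (sqrt_hs_le_sqrt_card_mul_norm)
open Prop7CovPinnedKernelL1OfRows (sqrt_hs_add_le)
open Prop7CovKernelOfTransplant (covLaplace_zero)
open Prop7TransplantGen1Engines (sqrt_weighted_hs_le_of_profile sqrt_weighted_hs_frameJunk_le_of_profile sqrt_sum_sq_mono sqrt_sum_sq_const sum_sq_add_le_two_mul)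
open Prop7CovKernelTransplantAssembly (sqrt_weighted_hs_add_le sqrt_weighted_hs_sub_le)

variable {P : Params} {i : ℕ} {N : ℕ}

/-! ## §1 Letters -/

/-- **THE POINTWISE FRAME-JUNK PROFILE UNDER SUP CONE ROWS**: `0 ≤ t₁ z ≤ T₁`, `0 ≤ t₂ z ≤ T₂`, `‖F z‖ ≤ q₀`, `‖F(T_μ^{±}z) − F z‖ ≤ q₁` (numbers at this `z`) give
`Σ_μ[(2t₂ z + 4(t₁ z)²)‖F z‖ + 2t₁ z‖F(T_μz) − F z‖ + 2t₁ z‖F(T_μ⁻¹z) − F z‖] ≤ d·((2T₂ + 4T₁²)q₀ + 4T₁q₁)`. [cite: Balaban1985BackgroundPropagators, (3.35) p.396] -/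
theorem frameJunk_pointwise_le (F : Site P i → Matrix (Fin N) (Fin N) ℂ) (z : Site P i) {t1 t2 T₁ T₂ q₀ q₁ : ℝ}
    (ht1 : 0 ≤ t1 ∧ t1 ≤ T₁) (ht2 : 0 ≤ t2 ∧ t2 ≤ T₂) (hq₀ : ‖F z‖ ≤ q₀)
    (hq₁ : ∀ μ, ‖F (torusT P i μ z) - F z‖ ≤ q₁ ∧ ‖F ((torusT P i μ).symm z) - F z‖ ≤ q₁) :
    ∑ μ : Fin P.d, ((2 * t2 + 4 * t1 ^ 2) * ‖F z‖ + 2 * t1 * ‖F (torusT P i μ z) - F z‖ + 2 * t1 * ‖F ((torusT P i μ).symm z) - F z‖)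
      ≤ P.d * ((2 * T₂ + 4 * T₁ ^ 2) * q₀ + 4 * T₁ * q₁) := by
  have hsq : t1 ^ 2 ≤ T₁ ^ 2 := pow_le_pow_left₀ ht1.1 ht1.2 2
  have hq0' : 0 ≤ q₀ := (norm_nonneg _).trans hq₀
  have hper : ∀ μ : Fin P.d, (2 * t2 + 4 * t1 ^ 2) * ‖F z‖ + 2 * t1 * ‖F (torusT P i μ z) - F z‖ + 2 * t1 * ‖F ((torusT P i μ).symm z) - F z‖
      ≤ (2 * T₂ + 4 * T₁ ^ 2) * q₀ + 4 * T₁ * q₁ := by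
    intro μ
    have hq1' : 0 ≤ q₁ := (norm_nonneg _).trans (hq₁ μ).1
    have a1 : (2 * t2 + 4 * t1 ^ 2) * ‖F z‖ ≤ (2 * T₂ + 4 * T₁ ^ 2) * q₀ :=
      mul_le_mul (by linarith) hq₀ (norm_nonneg _) (by nlinarith [sq_nonneg T₁])
    have a2 : 2 * t1 * ‖F (torusT P i μ z) - F z‖ ≤ 2 * T₁ * q₁ := mul_le_mul (by linarith) (hq₁ μ).1 (norm_nonneg _) (by linarith)
    have a3 : 2 * t1 * ‖F ((torusT P i μ).symm z) - F z‖ ≤ 2 * T₁ * q₁ := mul_le_mul (by linarith) (hq₁ μ).2 (norm_nonneg _) (by linarith)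
    linarith
  calc _ ≤ ∑ _μ : Fin P.d, ((2 * T₂ + 4 * T₁ ^ 2) * q₀ + 4 * T₁ * q₁) := Finset.sum_le_sum fun μ _ => hper μ
    _ = _ := by rw [Finset.sum_const, Finset.card_univ, Fintype.card_fin, nsmul_eq_mul]

/-- Cauchy–Schwarz on a finset: `Σ_{z∈S} q z ≤ √#S·√(Σ_{z∈S} (q z)²)`. [folklore] -/
theorem sum_le_sqrt_card_mul_sqrt_sum_sq (S : Finset (Site P i)) (q : Site P i → ℝ) :
    ∑ z ∈ S, q z ≤ Real.sqrt S.card * Real.sqrt (∑ z ∈ S, q z ^ 2) := by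
  have h := Real.sum_mul_le_sqrt_mul_sqrt S (fun _ => (1 : ℝ)) q
  simp only [one_mul, one_pow, Finset.sum_const, nsmul_eq_mul, mul_one] at h
  exact h

/-! ## §2 The gen-1 numbers -/

section Numbers

variable (U : Fin P.d → Site P i → (Matrix (Fin N) (Fin N) ℂ)ˣ) (Fr : Site P i → (Matrix (Fin N) (Fin N) ℂ)ˣ)
  (hU : ∀ (κ : Fin P.d) (y : Site P i), ‖(U κ y : Matrix (Fin N) (Fin N) ℂ)‖ ≤ 1 ∧ ‖(((U κ y)⁻¹ : (Matrix (Fin N) (Fin N) ℂ)ˣ) : Matrix (Fin N) (Fin N) ℂ)‖ ≤ 1)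
  (hFr : ∀ z : Site P i, ‖(Fr z : Matrix (Fin N) (Fin N) ℂ)‖ ≤ 1 ∧ ‖(((Fr z)⁻¹ : (Matrix (Fin N) (Fin N) ℂ)ˣ) : Matrix (Fin N) (Fin N) ℂ)‖ ≤ 1)
  (S : Finset (Site P i)) (t₁ t₂ : Site P i → ℝ) {T₁ T₂ : ℝ}
  (hT : ∀ z ∈ S, (0 ≤ t₁ z ∧ t₁ z ≤ T₁) ∧ (0 ≤ t₂ z ∧ t₂ z ≤ T₂))
  (h1 : ∀ z ∈ S, ∀ μ, ‖(((Fr z)⁻¹ * U μ z * Fr (torusT P i μ z) : (Matrix (Fin N) (Fin N) ℂ)ˣ) : Matrix (Fin N) (Fin N) ℂ) - 1‖ ≤ t₁ z)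
  (h1' : ∀ z ∈ S, ∀ μ, ‖(((Fr ((torusT P i μ).symm z))⁻¹ * U μ ((torusT P i μ).symm z) * Fr (torusT P i μ ((torusT P i μ).symm z)) : (Matrix (Fin N) (Fin N) ℂ)ˣ) :
    Matrix (Fin N) (Fin N) ℂ) - 1‖ ≤ t₁ z)
  (h2 : ∀ z ∈ S, ∀ μ, ‖(((Fr z)⁻¹ * U μ z * Fr (torusT P i μ z) : (Matrix (Fin N) (Fin N) ℂ)ˣ) : Matrix (Fin N) (Fin N) ℂ)
    - (((Fr ((torusT P i μ).symm z))⁻¹ * U μ ((torusT P i μ).symm z) * Fr (torusT P i μ ((torusT P i μ).symm z)) : (Matrix (Fin N) (Fin N) ℂ)ˣ) :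
      Matrix (Fin N) (Fin N) ℂ)‖ ≤ t₂ z)

include hU hFr hT h1 h1' h2

/-- ★★ **(N2₁) THE `ℓ¹` NUMBER OF THE gen-1 TRANSPLANT `R(Fr)F`**: with `Δ_flat F = F′ + c₁′`, `‖F′ z‖ ≤ p₀ z` and `‖c₁′ z‖ ≤ γ z` on `S`, uniform `‖F‖ ≤ Φ₀`, `‖∂^{±}F‖ ≤ Φ₁`, and `F` with its
neighbours vanishing off `S` (`γ p₀` pointwise row functions): `Σ_z √hs(Δ_U(R(Fr)F) z) ≤ √N·(Σ_{z∈S} p₀ z + Σ_{z∈S} γ z) + √N·(#S·d·((2T₂ + 4T₁²)Φ₀ + 4T₁Φ₁))`. [cite: Balaban1985BackgroundPropagators, (3.8) p.392, (3.35) p.396] -/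
theorem gen1_N2_le (F F' c₁' : Site P i → Matrix (Fin N) (Fin N) ℂ)
    (hSF : ∀ z ∉ S, F z = 0 ∧ (∀ μ, F (torusT P i μ z) = 0) ∧ ∀ μ, F ((torusT P i μ).symm z) = 0)
    (hFsplit : ∀ z, (∑ μ : Fin P.d, ((F z - F (torusT P i μ z)) + (F z - F ((torusT P i μ).symm z)))) = F' z + c₁' z)
    {Φ₀ Φ₁ : ℝ} (hΦ₀ : ∀ z, ‖F z‖ ≤ Φ₀) (hΦ₁ : ∀ z μ, ‖F (torusT P i μ z) - F z‖ ≤ Φ₁ ∧ ‖F ((torusT P i μ).symm z) - F z‖ ≤ Φ₁)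
    (γ p₀ : Site P i → ℝ) (hγ : ∀ z ∈ S, ‖c₁' z‖ ≤ γ z) (hp₀ : ∀ z ∈ S, ‖F' z‖ ≤ p₀ z) :
    ∑ z, Real.sqrt (∑ j : Fin N, ∑ k : Fin N, ‖(divB (torusT P i) U (fun μ => covD (torusT P i) U μ (fun y => R (Fr y) (F y))) z) j k‖ ^ 2)
      ≤ Real.sqrt N * (∑ z ∈ S, p₀ z + ∑ z ∈ S, γ z) + Real.sqrt N * (S.card * (P.d * ((2 * T₂ + 4 * T₁ ^ 2) * Φ₀ + 4 * T₁ * Φ₁))) := by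
  have h := sum_sqrt_hs_covLaplace_framed_le U Fr hU hFr F S hSF t₁ t₂ h1 h1' h2
  refine h.trans (add_le_add ?_ ?_)
  · -- main term: `√hs(Δ_flat F z) ≤ √N(‖F′ z‖ + ‖c₁′ z‖)`
    have hN : 0 ≤ Real.sqrt (N : ℝ) := Real.sqrt_nonneg _
    calc ∑ z ∈ S, Real.sqrt (∑ j : Fin N, ∑ k : Fin N, ‖(∑ μ : Fin P.d, ((F z - F (torusT P i μ z)) + (F z - F ((torusT P i μ).symm z)))) j k‖ ^ 2)
        ≤ ∑ z ∈ S, Real.sqrt N * (p₀ z + γ z) := by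
          refine Finset.sum_le_sum fun z hz => ?_
          rw [hFsplit z]
          refine (sqrt_hs_le_sqrt_card_mul_norm _).trans (mul_le_mul_of_nonneg_left ?_ hN)
          exact (norm_add_le _ _).trans (add_le_add (hp₀ z hz) (hγ z hz))
      _ = Real.sqrt N * (∑ z ∈ S, p₀ z + ∑ z ∈ S, γ z) := by
          rw [← Finset.mul_sum, Finset.sum_add_distrib]
  · -- junk term: sup cone rows
    refine mul_le_mul_of_nonneg_left ?_ (Real.sqrt_nonneg _)
    calc _ ≤ ∑ _z ∈ S, (P.d : ℝ) * ((2 * T₂ + 4 * T₁ ^ 2) * Φ₀ + 4 * T₁ * Φ₁) :=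
          Finset.sum_le_sum fun z hz => frameJunk_pointwise_le F z (hT z hz).1 (hT z hz).2 (hΦ₀ z) (hΦ₁ z)
      _ = _ := by rw [Finset.sum_const, nsmul_eq_mul]

/-- ★★ **(H₁) THE TYPE-1 NUMBER**: for `K₁ := Δ_U(R(Fr)F) − R(Fr)(Δ_flat F)` (uniform `Φ₀ Φ₁`), `c₁′` with `‖c₁′ z‖ ≤ γ z` on `S` (profile), `c₁′ = 0` off `S`, `0 ≤ ω ≤ Ω` on `S` (`0 ≤ Ω`):
`√Σω²hs(K₁ z + R(Fr z)(c₁′ z)) ≤ Ω·√N·√#S·d((2T₂ + 4T₁²)Φ₀ + 4T₁Φ₁) + Ω·√Σ_S (√N·γ)²`. [cite: Balaban1984PropagatorsII, (1.9) p.226; Balaban1985BackgroundPropagators, (3.35) p.396] -/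
theorem gen1_H1_le (F c₁' K₁ : Site P i → Matrix (Fin N) (Fin N) ℂ)
    (hSF : ∀ z ∉ S, F z = 0 ∧ (∀ μ, F (torusT P i μ z) = 0) ∧ ∀ μ, F ((torusT P i μ).symm z) = 0) (hSc : ∀ z ∉ S, c₁' z = 0)
    (hK₁ : ∀ z, K₁ z = divB (torusT P i) U (fun μ => covD (torusT P i) U μ (fun y => R (Fr y) (F y))) z
      - R (Fr z) (∑ μ : Fin P.d, ((F z - F (torusT P i μ z)) + (F z - F ((torusT P i μ).symm z)))))
    {Φ₀ Φ₁ : ℝ} (hΦ₀ : ∀ z, ‖F z‖ ≤ Φ₀) (hΦ₁ : ∀ z μ, ‖F (torusT P i μ z) - F z‖ ≤ Φ₁ ∧ ‖F ((torusT P i μ).symm z) - F z‖ ≤ Φ₁)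
    (γ : Site P i → ℝ) (hγ : ∀ z ∈ S, ‖c₁' z‖ ≤ γ z) (ω : Site P i → ℝ) {Ω : ℝ} (hΩ : 0 ≤ Ω) (hω : ∀ z ∈ S, 0 ≤ ω z ∧ ω z ≤ Ω) :
    Real.sqrt (∑ z, ω z ^ 2 * ∑ j : Fin N, ∑ k : Fin N, ‖(K₁ z + R (Fr z) (c₁' z)) j k‖ ^ 2)
      ≤ Ω * (Real.sqrt N * (Real.sqrt S.card * (P.d * ((2 * T₂ + 4 * T₁ ^ 2) * Φ₀ + 4 * T₁ * Φ₁))))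
        + Ω * Real.sqrt (∑ z ∈ S, (Real.sqrt N * γ z) ^ 2) := by
  refine (sqrt_weighted_hs_add_le ω K₁ (fun z => R (Fr z) (c₁' z))).trans ?_
  -- the `K₁` half via the profile engine with the constant profile
  have hK := sqrt_weighted_hs_frameJunk_le_of_profile U Fr hU hFr F S hSF t₁ t₂ h1 h1' h2 K₁ hK₁ ω hω
  have hprof : Real.sqrt (∑ z ∈ S, (∑ μ : Fin P.d, ((2 * t₂ z + 4 * t₁ z ^ 2) * ‖F z‖ + 2 * t₁ z * ‖F (torusT P i μ z) - F z‖
        + 2 * t₁ z * ‖F ((torusT P i μ).symm z) - F z‖)) ^ 2)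
      ≤ Real.sqrt S.card * (P.d * ((2 * T₂ + 4 * T₁ ^ 2) * Φ₀ + 4 * T₁ * Φ₁)) := by
    refine (sqrt_sum_sq_mono S (fun z hz => Finset.sum_nonneg fun μ _ => ?_)
      (fun z hz => frameJunk_pointwise_le F z (hT z hz).1 (hT z hz).2 (hΦ₀ z) (hΦ₁ z))).trans ?_
    · have := (hT z hz).1.1; have := (hT z hz).2.1; positivity
    · rw [sqrt_sum_sq_const]
      rcases S.eq_empty_or_nonempty with hS0 | ⟨z₀, hz₀⟩
      · subst hS0; simp
      · have hB0 : 0 ≤ (P.d : ℝ) * ((2 * T₂ + 4 * T₁ ^ 2) * Φ₀ + 4 * T₁ * Φ₁) :=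
          (Finset.sum_nonneg fun μ _ => by have := (hT z₀ hz₀).1.1; have := (hT z₀ hz₀).2.1; positivity).trans
            (frameJunk_pointwise_le F z₀ (hT z₀ hz₀).1 (hT z₀ hz₀).2 (hΦ₀ z₀) (hΦ₁ z₀))
        rw [abs_of_nonneg hB0]
  -- the `R(Fr)c₁′` half via the pointwise engine
  have hc : Real.sqrt (∑ z, ω z ^ 2 * ∑ j : Fin N, ∑ k : Fin N, ‖(R (Fr z) (c₁' z)) j k‖ ^ 2) ≤ Ω * Real.sqrt (∑ z ∈ S, (Real.sqrt N * γ z) ^ 2) :=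
    sqrt_weighted_hs_le_of_profile S (fun z => R (Fr z) (c₁' z)) (fun z hz => by show R (Fr z) (c₁' z) = 0; rw [hSc z hz, R_def]; simp) ω hω
      (fun z => Real.sqrt N * γ z) fun z hz =>
        (Real.sqrt_le_sqrt (hs_R_le (hFr z) (c₁' z))).trans ((sqrt_hs_le_sqrt_card_mul_norm _).trans (mul_le_mul_of_nonneg_left (hγ z hz) (Real.sqrt_nonneg _)))
  have a1 : Ω * (Real.sqrt N * Real.sqrt (∑ z ∈ S, (∑ μ : Fin P.d, ((2 * t₂ z + 4 * t₁ z ^ 2) * ‖F z‖ + 2 * t₁ z * ‖F (torusT P i μ z) - F z‖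
        + 2 * t₁ z * ‖F ((torusT P i μ).symm z) - F z‖)) ^ 2))
      ≤ Ω * (Real.sqrt N * (Real.sqrt S.card * (P.d * ((2 * T₂ + 4 * T₁ ^ 2) * Φ₀ + 4 * T₁ * Φ₁)))) :=
    mul_le_mul_of_nonneg_left (mul_le_mul_of_nonneg_left hprof (Real.sqrt_nonneg _)) hΩ
  exact add_le_add (hK.trans a1) hc

/-- ★★★ **(S₁) THE SITE NUMBER, PROFILE FORM**: for `K₂ := Δ_U(R(Fr)F′) − R(Fr)(Δ_flat F′)` with POINTWISE rows `‖F′ z‖ ≤ p₀ z`, `‖F′(T_μ^{±}z) − F′ z‖ ≤ p₁ z` on `S` (`F′` and neighbours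
vanishing off `S`), `c₂′` with `√N·‖c₂′ z‖ ≤ p₂ z` on `S`, `c₂′ = 0` off `S`, `0 ≤ p₀ p₁ p₂` on `S`, weight `0 ≤ ω ≤ Ω` on `S`:
`√Σω²hs(K₂ z − R(Fr z)(c₂′ z)) ≤ Ω·√N·√Σ_S (d((2T₂ + 4T₁²)p₀ + 4T₁p₁))² + Ω·√Σ_S p₂²`. [cite: Balaban1984PropagatorsII, (1.9) p.226; Balaban1985BackgroundPropagators, (3.35) p.396] -/
theorem gen1_S1_le (F' c₂' K₂ : Site P i → Matrix (Fin N) (Fin N) ℂ)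
    (hSF' : ∀ z ∉ S, F' z = 0 ∧ (∀ μ, F' (torusT P i μ z) = 0) ∧ ∀ μ, F' ((torusT P i μ).symm z) = 0) (hSc : ∀ z ∉ S, c₂' z = 0)
    (hK₂ : ∀ z, K₂ z = divB (torusT P i) U (fun μ => covD (torusT P i) U μ (fun y => R (Fr y) (F' y))) z
      - R (Fr z) (∑ ν : Fin P.d, ((F' z - F' (torusT P i ν z)) + (F' z - F' ((torusT P i ν).symm z)))))
    (p₀ p₁ p₂ : Site P i → ℝ)
    (hp₀ : ∀ z ∈ S, ‖F' z‖ ≤ p₀ z) (hp₁ : ∀ z ∈ S, ∀ μ, ‖F' (torusT P i μ z) - F' z‖ ≤ p₁ z ∧ ‖F' ((torusT P i μ).symm z) - F' z‖ ≤ p₁ z)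
    (hp₂ : ∀ z ∈ S, Real.sqrt N * ‖c₂' z‖ ≤ p₂ z) (ω : Site P i → ℝ) {Ω : ℝ} (hΩ : 0 ≤ Ω) (hω : ∀ z ∈ S, 0 ≤ ω z ∧ ω z ≤ Ω) :
    Real.sqrt (∑ z, ω z ^ 2 * ∑ j : Fin N, ∑ k : Fin N, ‖(K₂ z - R (Fr z) (c₂' z)) j k‖ ^ 2)
      ≤ Ω * (Real.sqrt N * Real.sqrt (∑ z ∈ S, (P.d * ((2 * T₂ + 4 * T₁ ^ 2) * p₀ z + 4 * T₁ * p₁ z)) ^ 2)) + Ω * Real.sqrt (∑ z ∈ S, p₂ z ^ 2) := by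
  refine (sqrt_weighted_hs_sub_le ω K₂ (fun z => R (Fr z) (c₂' z))).trans (add_le_add ?_ ?_)
  · have hK := sqrt_weighted_hs_frameJunk_le_of_profile U Fr hU hFr F' S hSF' t₁ t₂ h1 h1' h2 K₂ hK₂ ω hω
    have hprof : Real.sqrt (∑ z ∈ S, (∑ μ : Fin P.d, ((2 * t₂ z + 4 * t₁ z ^ 2) * ‖F' z‖ + 2 * t₁ z * ‖F' (torusT P i μ z) - F' z‖
          + 2 * t₁ z * ‖F' ((torusT P i μ).symm z) - F' z‖)) ^ 2)
        ≤ Real.sqrt (∑ z ∈ S, (P.d * ((2 * T₂ + 4 * T₁ ^ 2) * p₀ z + 4 * T₁ * p₁ z)) ^ 2) :=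
      sqrt_sum_sq_mono S (fun z hz => Finset.sum_nonneg fun μ _ => by have := (hT z hz).1.1; have := (hT z hz).2.1; positivity)
        (fun z hz => frameJunk_pointwise_le F' z (hT z hz).1 (hT z hz).2 (hp₀ z hz) (hp₁ z hz))
    exact hK.trans (mul_le_mul_of_nonneg_left (mul_le_mul_of_nonneg_left hprof (Real.sqrt_nonneg _)) hΩ)
  · refine sqrt_weighted_hs_le_of_profile S (fun z => R (Fr z) (c₂' z)) (fun z hz => by show R (Fr z) (c₂' z) = 0; rw [hSc z hz, R_def]; simp) ω hω p₂
      fun z hz => ?_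
    exact (Real.sqrt_le_sqrt (hs_R_le (hFr z) (c₂' z))).trans ((sqrt_hs_le_sqrt_card_mul_norm _).trans (hp₂ z hz))

omit hU hFr hT h1 h1' h2 in
/-- **(N3₁)(N4₁) VANISH FOR THE ZERO NEAR DATUM** `u₁ := 0` (px11 g4 (D4): the gen-1 field is corrected by bumps to vanish on the centres). [cite: Balaban1985RegularSpaces, (1.36) p.82] -/
theorem gen1_N3_N4_zero (ω : Site P i → ℝ) :
    ∑ z, Real.sqrt (∑ j : Fin N, ∑ k : Fin N, ‖(divB (torusT P i) U (fun μ => covD (torusT P i) U μ (fun _ : Site P i => (0 : Matrix (Fin N) (Fin N) ℂ))) z) j k‖ ^ 2) ≤ 0 ∧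
      Real.sqrt (∑ z, ω z ^ 2 * ∑ j : Fin N, ∑ k : Fin N,
        ‖(divB (torusT P i) U (fun μ => covD (torusT P i) U μ (fun _ : Site P i => (0 : Matrix (Fin N) (Fin N) ℂ))) z) j k‖ ^ 2) ≤ 0 := by
  simp only [covLaplace_zero, Matrix.zero_apply, norm_zero, ne_eq, OfNat.ofNat_ne_zero, not_false_eq_true, zero_pow, Finset.sum_const_zero, mul_zero,
    Real.sqrt_zero, le_refl, and_self]

end Numbers

/-! ## §3 ★★★ Closed forms under the cone letters of record and the radial profile shapes -/

/-- three-term square bookkeeping: `Σ_S(a+b+c)² ≤ 4Σa² + 4Σb² + 2Σc²`. [folklore] -/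
theorem sum_sq_add_three_le (S : Finset (Site P i)) (a b c : Site P i → ℝ) :
    ∑ z ∈ S, (a z + b z + c z) ^ 2 ≤ 4 * ∑ z ∈ S, a z ^ 2 + 4 * ∑ z ∈ S, b z ^ 2 + 2 * ∑ z ∈ S, c z ^ 2 := by
  have h1 := sum_sq_add_le_two_mul S (fun z => a z + b z) c
  have h2 := sum_sq_add_le_two_mul S a b
  linarith

open Prop7TransplantGen1Engines (sum_sq_div_max_le sum_sq_sqrt_div_max_le) in
open Prop7TorusGreenConvolution (sum_inv_max_le) in
/-- ★★★ **THE gen-1 NUMBERS IN CLOSED FORM** (px11 g4's (R-a)(R-b)(R-c) shapes) — at a pole `b`, two finsets `S ⊆ S′` with `S ⊆ {tdist(·,b) ≤ R}`, `S′ ⊆ {tdist(·,b) ≤ R′}`; cone rows in px22's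
letters `t₁ z := A₁(tdist(z,b) + 1)`, `t₂ z := A₀ + A₂(tdist(z,b) + 2)` and weight `0 ≤ ω ≤ Ω` on `S′` (sups `T₁ := A₁(R′+1)`, `T₂ := A₀ + A₂(R′+2)`); gen-1 fields with `F` (+ nbrs) and
`c₁′` vanishing off `S′`, `F′` (+ nbrs) and `c₂′` vanishing off `S`, `Δ_flat F = F′ + c₁′`; rows: uniform `‖F‖ ≤ Φ₀`, `‖∂^±F‖ ≤ Φ₁`; PROFILES `‖c₁′ z‖ ≤ Γ₁ + γ₁∕(1∨r)` on `S′`,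
`‖F′ z‖ ≤ a₀√(R₀∕(1∨r))`, `‖F′(T^±z) − F′ z‖ ≤ a₁∕(1∨r) + a₁′√(R₀∕(1∨r))`, `‖c₂′ z‖ ≤ a₃ + a₂∕(1∨r) + a₄√(R₄∕(1∨r))` on `S` (`r = tdist(z,b)`).  Conclusions (N2₁)(H₁)(S₁)(N3₁ N4₁) in
closed form, every radius explicit, pure `d = 3` counting over §2 and ✓p682215 §3 ∕ ✓p673901 `sum_inv_max_le`.
[cite: Balaban1985BackgroundPropagators, (3.8) p.392, (3.35) p.396; Balaban1984PropagatorsII, (1.9) p.226; Balaban1985RegularSpaces, (1.36) p.82] -/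
theorem gen1_numbers_closed (hd : P.d = 3) (U : Fin P.d → Site P i → (Matrix (Fin N) (Fin N) ℂ)ˣ) (Fr : Site P i → (Matrix (Fin N) (Fin N) ℂ)ˣ)
    (hU : ∀ (κ : Fin P.d) (y : Site P i), ‖(U κ y : Matrix (Fin N) (Fin N) ℂ)‖ ≤ 1 ∧ ‖(((U κ y)⁻¹ : (Matrix (Fin N) (Fin N) ℂ)ˣ) : Matrix (Fin N) (Fin N) ℂ)‖ ≤ 1)
    (hFr : ∀ z : Site P i, ‖(Fr z : Matrix (Fin N) (Fin N) ℂ)‖ ≤ 1 ∧ ‖(((Fr z)⁻¹ : (Matrix (Fin N) (Fin N) ℂ)ˣ) : Matrix (Fin N) (Fin N) ℂ)‖ ≤ 1)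
    (b : Site P i) (S S' : Finset (Site P i)) (R' R'' : ℕ) (hS : ∀ z ∈ S, Site.tdist z b ≤ R') (hS' : ∀ z ∈ S', Site.tdist z b ≤ R'') (hSS' : S ⊆ S')
    {A₀ A₁ A₂ : ℝ} (hA₀ : 0 ≤ A₀) (hA₁ : 0 ≤ A₁) (hA₂ : 0 ≤ A₂)
    (h1 : ∀ z ∈ S', ∀ μ, ‖(((Fr z)⁻¹ * U μ z * Fr (torusT P i μ z) : (Matrix (Fin N) (Fin N) ℂ)ˣ) : Matrix (Fin N) (Fin N) ℂ) - 1‖ ≤ A₁ * ((Site.tdist z b : ℝ) + 1))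
    (h1' : ∀ z ∈ S', ∀ μ, ‖(((Fr ((torusT P i μ).symm z))⁻¹ * U μ ((torusT P i μ).symm z) * Fr (torusT P i μ ((torusT P i μ).symm z)) : (Matrix (Fin N) (Fin N) ℂ)ˣ) :
      Matrix (Fin N) (Fin N) ℂ) - 1‖ ≤ A₁ * ((Site.tdist z b : ℝ) + 1))
    (h2 : ∀ z ∈ S', ∀ μ, ‖(((Fr z)⁻¹ * U μ z * Fr (torusT P i μ z) : (Matrix (Fin N) (Fin N) ℂ)ˣ) : Matrix (Fin N) (Fin N) ℂ)
      - (((Fr ((torusT P i μ).symm z))⁻¹ * U μ ((torusT P i μ).symm z) * Fr (torusT P i μ ((torusT P i μ).symm z)) : (Matrix (Fin N) (Fin N) ℂ)ˣ) :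
        Matrix (Fin N) (Fin N) ℂ)‖ ≤ A₀ + A₂ * ((Site.tdist z b : ℝ) + 2))
    (ω : Site P i → ℝ) {Ω : ℝ} (hΩ : 0 ≤ Ω) (hω : ∀ z ∈ S', 0 ≤ ω z ∧ ω z ≤ Ω)
    -- the gen-1 fields and their rows
    (F F' c₁' c₂' K₁ K₂ : Site P i → Matrix (Fin N) (Fin N) ℂ)
    (hSF : ∀ z ∉ S', F z = 0 ∧ (∀ μ, F (torusT P i μ z) = 0) ∧ ∀ μ, F ((torusT P i μ).symm z) = 0)
    (hSF' : ∀ z ∉ S, F' z = 0 ∧ (∀ μ, F' (torusT P i μ z) = 0) ∧ ∀ μ, F' ((torusT P i μ).symm z) = 0)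
    (hSc₁ : ∀ z ∉ S', c₁' z = 0) (hSc₂ : ∀ z ∉ S, c₂' z = 0)
    (hFsplit : ∀ z, (∑ μ : Fin P.d, ((F z - F (torusT P i μ z)) + (F z - F ((torusT P i μ).symm z)))) = F' z + c₁' z)
    (hK₁ : ∀ z, K₁ z = divB (torusT P i) U (fun μ => covD (torusT P i) U μ (fun y => R (Fr y) (F y))) z
      - R (Fr z) (∑ μ : Fin P.d, ((F z - F (torusT P i μ z)) + (F z - F ((torusT P i μ).symm z)))))
    (hK₂ : ∀ z, K₂ z = divB (torusT P i) U (fun μ => covD (torusT P i) U μ (fun y => R (Fr y) (F' y))) z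
      - R (Fr z) (∑ ν : Fin P.d, ((F' z - F' (torusT P i ν z)) + (F' z - F' ((torusT P i ν).symm z)))))
    {Φ₀ Φ₁ Γ₁ γ₁ a₀ R₀ a₁ a₁' a₂ a₃ a₄ R₄ : ℝ} (hγ₁0 : 0 ≤ γ₁) (hR₀ : 0 ≤ R₀) (hR₄ : 0 ≤ R₄)
    (hΦ₀ : ∀ z, ‖F z‖ ≤ Φ₀) (hΦ₁ : ∀ z μ, ‖F (torusT P i μ z) - F z‖ ≤ Φ₁ ∧ ‖F ((torusT P i μ).symm z) - F z‖ ≤ Φ₁)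
    (hΓ₁ : ∀ z ∈ S', ‖c₁' z‖ ≤ Γ₁ + γ₁ / max 1 ((Site.tdist z b : ℕ) : ℝ))
    (hp₀ : ∀ z ∈ S, ‖F' z‖ ≤ a₀ * Real.sqrt (R₀ / max 1 ((Site.tdist z b : ℕ) : ℝ)))
    (hp₁ : ∀ z ∈ S, ∀ μ, ‖F' (torusT P i μ z) - F' z‖ ≤ a₁ / max 1 ((Site.tdist z b : ℕ) : ℝ) + a₁' * Real.sqrt (R₀ / max 1 ((Site.tdist z b : ℕ) : ℝ))
      ∧ ‖F' ((torusT P i μ).symm z) - F' z‖ ≤ a₁ / max 1 ((Site.tdist z b : ℕ) : ℝ) + a₁' * Real.sqrt (R₀ / max 1 ((Site.tdist z b : ℕ) : ℝ)))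
    (hp₂ : ∀ z ∈ S, ‖c₂' z‖ ≤ a₃ + a₂ / max 1 ((Site.tdist z b : ℕ) : ℝ) + a₄ * Real.sqrt (R₄ / max 1 ((Site.tdist z b : ℕ) : ℝ))) :
    -- (N2₁)
    (∑ z, Real.sqrt (∑ j : Fin N, ∑ k : Fin N, ‖(divB (torusT P i) U (fun μ => covD (torusT P i) U μ (fun y => R (Fr y) (F y))) z) j k‖ ^ 2)
      ≤ Real.sqrt N * (Real.sqrt S.card * Real.sqrt (a₀ ^ 2 * R₀ * (8 + 128 * (R' : ℝ) ^ 2)) + (S'.card * Γ₁ + γ₁ * (8 + 128 * (R'' : ℝ) ^ 2)))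
        + Real.sqrt N * (S'.card * (P.d * ((2 * (A₀ + A₂ * (R'' + 2)) + 4 * (A₁ * (R'' + 1)) ^ 2) * Φ₀ + 4 * (A₁ * (R'' + 1)) * Φ₁)))) ∧
    -- (H₁)
    Real.sqrt (∑ z, ω z ^ 2 * ∑ j : Fin N, ∑ k : Fin N, ‖(K₁ z + R (Fr z) (c₁' z)) j k‖ ^ 2)
      ≤ Ω * (Real.sqrt N * (Real.sqrt S'.card * (P.d * ((2 * (A₀ + A₂ * (R'' + 2)) + 4 * (A₁ * (R'' + 1)) ^ 2) * Φ₀ + 4 * (A₁ * (R'' + 1)) * Φ₁))))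
        + Ω * Real.sqrt (N * (2 * (S'.card * Γ₁ ^ 2) + 2 * (γ₁ ^ 2 * (8 + 192 * (R'' : ℝ))))) ∧
    -- (S₁)
    Real.sqrt (∑ z, ω z ^ 2 * ∑ j : Fin N, ∑ k : Fin N, ‖(K₂ z - R (Fr z) (c₂' z)) j k‖ ^ 2)
      ≤ Ω * (Real.sqrt N * Real.sqrt (2 * ((P.d * ((2 * (A₀ + A₂ * (R'' + 2)) + 4 * (A₁ * (R'' + 1)) ^ 2) * a₀ + 4 * (A₁ * (R'' + 1)) * a₁')) ^ 2 * R₀ * (8 + 128 * (R' : ℝ) ^ 2))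
          + 2 * ((P.d * (4 * (A₁ * (R'' + 1)) * a₁)) ^ 2 * (8 + 192 * (R' : ℝ)))))
        + Ω * Real.sqrt (N * (4 * (S.card * a₃ ^ 2) + 4 * (a₂ ^ 2 * (8 + 192 * (R' : ℝ))) + 2 * (a₄ ^ 2 * R₄ * (8 + 128 * (R' : ℝ) ^ 2)))) ∧
    -- (N3₁), (N4₁) at `u₁ := 0`
    (∑ z, Real.sqrt (∑ j : Fin N, ∑ k : Fin N, ‖(divB (torusT P i) U (fun μ => covD (torusT P i) U μ (fun _ : Site P i => (0 : Matrix (Fin N) (Fin N) ℂ))) z) j k‖ ^ 2) ≤ 0 ∧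
      Real.sqrt (∑ z, ω z ^ 2 * ∑ j : Fin N, ∑ k : Fin N,
        ‖(divB (torusT P i) U (fun μ => covD (torusT P i) U μ (fun _ : Site P i => (0 : Matrix (Fin N) (Fin N) ℂ))) z) j k‖ ^ 2) ≤ 0) := by
  -- the cone letters as row functions with sups on `S′`
  set T₁ : ℝ := A₁ * (R'' + 1) with hT₁
  set T₂ : ℝ := A₀ + A₂ * (R'' + 2) with hT₂
  have hT : ∀ z ∈ S', (0 ≤ A₁ * ((Site.tdist z b : ℝ) + 1) ∧ A₁ * ((Site.tdist z b : ℝ) + 1) ≤ T₁) ∧ (0 ≤ A₀ + A₂ * ((Site.tdist z b : ℝ) + 2) ∧ A₀ + A₂ * ((Site.tdist z b : ℝ) + 2) ≤ T₂) := by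
    intro z hz
    have hr : ((Site.tdist z b : ℕ) : ℝ) ≤ R'' := by exact_mod_cast hS' z hz
    refine ⟨⟨by positivity, ?_⟩, ⟨by positivity, ?_⟩⟩
    · rw [hT₁]; exact mul_le_mul_of_nonneg_left (by linarith) hA₁
    · rw [hT₂]; nlinarith
  have hm0 : ∀ z : Site P i, 0 < max 1 ((Site.tdist z b : ℕ) : ℝ) := fun z => lt_of_lt_of_le one_pos (le_max_left _ _)
  -- everything supported in `S` is supported in `S′`
  have hSF'S' : ∀ z ∉ S', F' z = 0 ∧ (∀ μ, F' (torusT P i μ z) = 0) ∧ ∀ μ, F' ((torusT P i μ).symm z) = 0 := fun z hz => hSF' z (fun h => hz (hSS' h))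
  have hSc₂' : ∀ z ∉ S', c₂' z = 0 := fun z hz => hSc₂ z (fun h => hz (hSS' h))
  refine ⟨?_, ?_, ?_, gen1_N3_N4_zero U ω⟩
  · -- (N2₁) over `S′`, with the `F′` profile cut to `S`
    classical
    have hp₀S : ∀ z ∈ S', ‖F' z‖ ≤ (fun z => if z ∈ S then a₀ * Real.sqrt (R₀ / max 1 ((Site.tdist z b : ℕ) : ℝ)) else 0) z := by
      intro z _
      by_cases h : z ∈ S
      · simp only [h, if_true]; exact hp₀ z h
      · simp only [h, if_false]; rw [(hSF' z h).1, norm_zero]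
    have h := gen1_N2_le U Fr hU hFr S' (fun z => A₁ * ((Site.tdist z b : ℝ) + 1)) (fun z => A₀ + A₂ * ((Site.tdist z b : ℝ) + 2)) hT h1 h1' h2 F F' c₁' hSF hFsplit hΦ₀ hΦ₁
      (fun z => Γ₁ + γ₁ / max 1 ((Site.tdist z b : ℕ) : ℝ)) _ hΓ₁ hp₀S
    refine h.trans (add_le_add (mul_le_mul_of_nonneg_left (add_le_add ?_ ?_) (Real.sqrt_nonneg _)) le_rfl)
    · -- `Σ_{S′} p₀·𝟙_S = Σ_S p₀ ≤ √#S·√Σ_S p₀²`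
      rw [Finset.sum_ite_mem, Finset.inter_eq_right.2 hSS']
      refine (sum_le_sqrt_card_mul_sqrt_sum_sq S _).trans (mul_le_mul_of_nonneg_left (Real.sqrt_le_sqrt ?_) (Real.sqrt_nonneg _))
      exact sum_sq_sqrt_div_max_le hd S b R' hS a₀ hR₀
    · -- `Σ_{S′} (Γ₁ + γ₁∕(1∨r)) = #S′Γ₁ + γ₁Σ(1∨r)⁻¹`
      rw [Finset.sum_add_distrib, Finset.sum_const, nsmul_eq_mul]
      refine add_le_add le_rfl ?_
      have hs := sum_inv_max_le hd S' b R'' hS'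
      have e : ∑ z ∈ S', γ₁ / max 1 ((Site.tdist z b : ℕ) : ℝ) = γ₁ * ∑ z ∈ S', (max 1 ((Site.tdist z b : ℕ) : ℝ))⁻¹ := by
        rw [Finset.mul_sum]; exact Finset.sum_congr rfl fun z _ => div_eq_mul_inv _ _
      rw [e]
      exact mul_le_mul_of_nonneg_left hs hγ₁0
  · -- (H₁) over `S′`
    have h := gen1_H1_le U Fr hU hFr S' (fun z => A₁ * ((Site.tdist z b : ℝ) + 1)) (fun z => A₀ + A₂ * ((Site.tdist z b : ℝ) + 2)) hT h1 h1' h2 F c₁' K₁ hSF hSc₁ hK₁ hΦ₀ hΦ₁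
      (fun z => Γ₁ + γ₁ / max 1 ((Site.tdist z b : ℕ) : ℝ)) hΓ₁ ω hΩ hω
    refine h.trans (add_le_add le_rfl (mul_le_mul_of_nonneg_left (Real.sqrt_le_sqrt ?_) hΩ))
    have e : ∀ z, (Real.sqrt N * (Γ₁ + γ₁ / max 1 ((Site.tdist z b : ℕ) : ℝ))) ^ 2 = (N : ℝ) * (Γ₁ + γ₁ / max 1 ((Site.tdist z b : ℕ) : ℝ)) ^ 2 := by
      intro z; rw [mul_pow, Real.sq_sqrt (Nat.cast_nonneg _)]
    simp only [e]
    rw [← Finset.mul_sum]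
    refine mul_le_mul_of_nonneg_left ?_ (Nat.cast_nonneg _)
    refine (sum_sq_add_le_two_mul S' _ _).trans ?_
    have hs1 : ∑ _z ∈ S', Γ₁ ^ 2 = S'.card * Γ₁ ^ 2 := by rw [Finset.sum_const, nsmul_eq_mul]
    have hs2 := sum_sq_div_max_le hd S' b R'' hS' γ₁
    rw [hs1]
    linarith
  · -- (S₁) over `S`
    have hTS : ∀ z ∈ S, (0 ≤ A₁ * ((Site.tdist z b : ℝ) + 1) ∧ A₁ * ((Site.tdist z b : ℝ) + 1) ≤ T₁) ∧ (0 ≤ A₀ + A₂ * ((Site.tdist z b : ℝ) + 2) ∧ A₀ + A₂ * ((Site.tdist z b : ℝ) + 2) ≤ T₂) :=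
      fun z hz => hT z (hSS' hz)
    have h := gen1_S1_le U Fr hU hFr S (fun z => A₁ * ((Site.tdist z b : ℝ) + 1)) (fun z => A₀ + A₂ * ((Site.tdist z b : ℝ) + 2)) hTS
      (fun z hz => h1 z (hSS' hz)) (fun z hz => h1' z (hSS' hz)) (fun z hz => h2 z (hSS' hz)) F' c₂' K₂ hSF' hSc₂ hK₂
      (fun z => a₀ * Real.sqrt (R₀ / max 1 ((Site.tdist z b : ℕ) : ℝ)))
      (fun z => a₁ / max 1 ((Site.tdist z b : ℕ) : ℝ) + a₁' * Real.sqrt (R₀ / max 1 ((Site.tdist z b : ℕ) : ℝ)))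
      (fun z => Real.sqrt N * (a₃ + a₂ / max 1 ((Site.tdist z b : ℕ) : ℝ) + a₄ * Real.sqrt (R₄ / max 1 ((Site.tdist z b : ℕ) : ℝ))))
      hp₀ hp₁ (fun z hz => mul_le_mul_of_nonneg_left (hp₂ z hz) (Real.sqrt_nonneg _)) ω hΩ (fun z hz => hω z (hSS' hz))
    refine h.trans (add_le_add (mul_le_mul_of_nonneg_left (mul_le_mul_of_nonneg_left (Real.sqrt_le_sqrt ?_) (Real.sqrt_nonneg _)) hΩ)
      (mul_le_mul_of_nonneg_left (Real.sqrt_le_sqrt ?_) hΩ))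
    · -- the frame-junk profile of `F′`: two shapes
      have e : ∀ z, (P.d : ℝ) * ((2 * T₂ + 4 * T₁ ^ 2) * (a₀ * Real.sqrt (R₀ / max 1 ((Site.tdist z b : ℕ) : ℝ)))
            + 4 * T₁ * (a₁ / max 1 ((Site.tdist z b : ℕ) : ℝ) + a₁' * Real.sqrt (R₀ / max 1 ((Site.tdist z b : ℕ) : ℝ))))
          = (P.d * ((2 * T₂ + 4 * T₁ ^ 2) * a₀ + 4 * T₁ * a₁')) * Real.sqrt (R₀ / max 1 ((Site.tdist z b : ℕ) : ℝ)) + (P.d * (4 * T₁ * a₁)) / max 1 ((Site.tdist z b : ℕ) : ℝ) := by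
        intro z; ring
      simp only [e]
      refine (sum_sq_add_le_two_mul S _ _).trans ?_
      have hs1 := sum_sq_sqrt_div_max_le hd S b R' hS (P.d * ((2 * T₂ + 4 * T₁ ^ 2) * a₀ + 4 * T₁ * a₁')) hR₀
      have hs2 := sum_sq_div_max_le hd S b R' hS (P.d * (4 * T₁ * a₁))
      simp only [hT₁, hT₂] at hs1 hs2 ⊢
      linarith [hs1, hs2]
    · -- the `c₂′` profile: three shapes
      have e : ∀ z, (Real.sqrt N * (a₃ + a₂ / max 1 ((Site.tdist z b : ℕ) : ℝ) + a₄ * Real.sqrt (R₄ / max 1 ((Site.tdist z b : ℕ) : ℝ)))) ^ 2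
          = (N : ℝ) * (a₃ + a₂ / max 1 ((Site.tdist z b : ℕ) : ℝ) + a₄ * Real.sqrt (R₄ / max 1 ((Site.tdist z b : ℕ) : ℝ))) ^ 2 := by
        intro z; rw [mul_pow, Real.sq_sqrt (Nat.cast_nonneg _)]
      simp only [e]
      rw [← Finset.mul_sum]
      refine mul_le_mul_of_nonneg_left ?_ (Nat.cast_nonneg _)
      refine (sum_sq_add_three_le S _ _ _).trans ?_
      have hs1 : ∑ _z ∈ S, a₃ ^ 2 = S.card * a₃ ^ 2 := by rw [Finset.sum_const, nsmul_eq_mul]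
      have hs2 := sum_sq_div_max_le hd S b R' hS a₂
      have hs3 := sum_sq_sqrt_div_max_le hd S b R' hS a₄ hR₄
      rw [hs1]
      linarith [hs2, hs3]

end Summit.QuantumFields.YangMills.Theorems.Prop7TransplantGen1Numbers

end
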